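import Mathlib
import Literature.NumberTheory.Transcendental.KZCalculus
import Summits.KontsevichZagierPeriods.KontsevichZagierPeriods.Theorems.TorsionLogsNeronTorsionSectorStubLowerRegular
import Summits.KontsevichZagierPeriods.KontsevichZagierPeriods.Theorems.TorsionLogsNeronTorsionSectorStubTranslationCalculus
import Summits.KontsevichZagierPeriods.KontsevichZagierPeriods.Theorems.TorsionLogsNeronTorsionSectorStubDlogPotential
import Summits.KontsevichZagierPeriods.KontsevichZagierPeriods.Theorems.TorsionLogsNeronTorsionSectorAssemblyDecomp
import HarnessLib

/-!
# Crux `TorsionLogs.NeronTorsionSector` (stmt-KontsevichZagierPeriods-14500) — assembly, the row package (lower branch)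

Helper for the lead's stub `stub_assembly` (line `registered`): from the torsion grid (`stub_gridData`: the interval
behaviour of the lower translation `τ` on the cells) and the landed `stub_lowerRegular`, the per-cell analytic
facts consumed by the translation steps (`stub_upStepInst`, `stub_foldStepInst`, `stub_cellStepInst`) and the
regular logs (`stub_logStep`): on each closed cell `[x (j+1), x j]` (`1 ≤ j ≤ m − 2`) the translation has values
in the next cell, the Haar identity holds, the third-kind potential `Qf` is continuous with the expected derivative,
and the dlog potential `G` is continuous, non-vanishing, with logarithmic derivative `(Qf∘τ − Qf)/yb`; the fold cell
`[e₁, x (m−1)]` has the same step facts. [cite: KontsevichZagier2001, §1.2] [cite: SilvermanAEC2009, III.2.3]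
-/

noncomputable section

open Set MeasureTheory Filter Topology
open Literature.NumberTheory.Transcendental Literature.ModelTheory.ExponentialFields

-- `Summit.KontsevichZagierPeriods.KontsevichZagierPeriods.…` is the tree's mandated layout (single-conjunct summit).
set_option linter.dupNamespace false

namespace Summit.KontsevichZagierPeriods.KontsevichZagierPeriods.Cruxes.NeronTorsionSector.Translation

/-- **The row package** (see the module docstring). Hypotheses: the grid `x 1 > ⋯ > x m = e₁` with its `τ`-interval
facts (conclusion shape of `stub_gridData`) and the data of `stub_lowerRegular`. [cite: KontsevichZagier2001, §1.2] -/
theorem asmRows_package :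
    ∀ (g₂ g₃ e₁ L₁ : ℝ) (m : ℕ) (x y : ℕ → ℝ) (f yb sl τ Y3 Qf sl3 X33 Y33 Qf3 Pg G τ' : ℝ → ℝ),
    (∀ t, f t = 4 * t ^ 3 - g₂ * t - g₃) → f e₁ = 0 → 0 < e₁ → (∀ t, e₁ < t → 0 < f t) →
    6 ≤ m → x m = e₁ →
    (∀ k, 1 ≤ k → k < m → e₁ < x k ∧ y k < 0) → (∀ k, 1 ≤ k → k < m → x (k + 1) < x k) →
    (∀ k, 1 ≤ k → k ≤ m → IsAlgebraic ℚ (x k)) →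
    y 1 ^ 2 = f (x 1) → IsAlgebraic ℚ (y 1) → IsAlgebraic ℚ g₂ → IsAlgebraic ℚ g₃ →
    L₁ = (12 * x 1 ^ 2 - g₂) / (2 * y 1) → x 2 = L₁ ^ 2 / 4 - 2 * x 1 → y 2 = -(y 1 + L₁ * (x 2 - x 1)) →
    yb = (fun t => -Real.sqrt (f t)) →
    sl = (fun t => (4 * t ^ 2 + 4 * t * x 1 + 4 * x 1 ^ 2 - g₂) / (yb t + y 1)) →
    τ = (fun t => sl t ^ 2 / 4 - t - x 1) →
    Y3 = (fun t => -(yb t + sl t * (τ t - t))) →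
    Qf = (fun t => sl t / 2 + Y3 t / (2 * τ t) - yb t / (2 * t)) →
    sl3 = (fun t => (4 * τ t ^ 2 + 4 * τ t * x 1 + 4 * x 1 ^ 2 - g₂) / (Y3 t + y 1)) →
    X33 = (fun t => sl3 t ^ 2 / 4 - τ t - x 1) →
    Y33 = (fun t => -(Y3 t + sl3 t * (X33 t - τ t))) →
    Qf3 = (fun t => sl3 t / 2 + Y33 t / (2 * X33 t) - Y3 t / (2 * τ t)) →
    Pg = (fun t => 4 * (t + 2 * x 1) * y 1 - L₁ * (4 * t ^ 2 + 4 * t * x 1 + 4 * x 1 ^ 2 - g₂)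
      + 4 * (t + 2 * x 1) * yb t) →
    G = (fun t => Pg t / (yb t + y 1) ^ 2 * Real.sqrt (t * X33 t) / τ t) →
    τ' = (fun t => Y3 t / yb t) →
    StrictMonoOn τ (Set.Ici (x 1)) → τ '' Set.Ioi (x 1) = Set.Ioo (x 2) (x 1) →
    (∀ k, 1 ≤ k → k + 2 ≤ m → StrictMonoOn τ (Set.Icc (x (k + 1)) (x k)) ∧
      τ '' Set.Ioo (x (k + 1)) (x k) = Set.Ioo (x (k + 2)) (x (k + 1)) ∧
      τ (x k) = x (k + 1) ∧ τ (x (k + 1)) = x (k + 2)) →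
    StrictAntiOn τ (Set.Icc e₁ (x (m - 1))) → τ '' Set.Ioo e₁ (x (m - 1)) = Set.Ioo e₁ (x (m - 1)) →
    τ e₁ = x (m - 1) → τ (x (m - 1)) = e₁ →
    -- conclusions
    (∀ t, x (m - 1) < t → e₁ < τ t) ∧
    (∀ t, x (m - 1) < t → Y3 t < 0) ∧
    Continuous τ ∧ (∀ t, e₁ ≤ t → yb t + y 1 < 0) ∧
    (∀ S : Set ℝ, IsSemialgebraic ℚ {p : Fin 1 → ℝ | p 0 ∈ S} →
      IsSemialgebraicFunOn ℚ {p : Fin 1 → ℝ | p 0 ∈ S} (fun p => τ (p 0)) ∧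
      IsSemialgebraicFunOn ℚ {p : Fin 1 → ℝ | p 0 ∈ S} (fun p => Qf (p 0)) ∧
      IsSemialgebraicFunOn ℚ {p : Fin 1 → ℝ | p 0 ∈ S} (fun p => G (p 0)) ∧
      IsSemialgebraicFunOn ℚ {p : Fin 1 → ℝ | p 0 ∈ S} (fun p => τ' (p 0))) ∧
    -- regular cells `[x (j+1), x j]`, `1 ≤ j ≤ m − 2`
    (∀ j, 1 ≤ j → j + 2 ≤ m →
      (∀ t ∈ Set.Icc (x (j + 1)) (x j), e₁ < t ∧ x (j + 2) ≤ τ t ∧ τ t ≤ x (j + 1) ∧ e₁ ≤ τ t ∧ τ t < x 1) ∧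
      (∀ t ∈ Set.Ioo (x (j + 1)) (x j),
        HasDerivAt τ (τ' t) t ∧ |τ' t| * Real.sqrt (f t) = Real.sqrt (f (τ t))) ∧
      ContinuousOn Qf (Set.Icc (x (j + 1)) (x j)) ∧
      (∀ t ∈ Set.Ioo (x (j + 1)) (x j), HasDerivAt Qf
        (((g₂ * τ t + 2 * g₃) / (4 * τ t ^ 2) - (g₂ * t + 2 * g₃) / (4 * t ^ 2)) / (-Real.sqrt (f t))) t) ∧
      ContinuousOn G (Set.Icc (x (j + 1)) (x j)) ∧ (∀ t ∈ Set.Icc (x (j + 1)) (x j), G t ≠ 0) ∧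
      (∀ t ∈ Set.Ioo (x (j + 1)) (x j), HasDerivAt G (G t * ((Qf (τ t) - Qf t) / yb t)) t)) ∧
    -- the fold cell `[e₁, x (m−1)]`
    ((∀ t ∈ Set.Ioo e₁ (x (m - 1)),
        HasDerivAt τ (τ' t) t ∧ |τ' t| * Real.sqrt (f t) = Real.sqrt (f (τ t))) ∧
      ContinuousOn Qf (Set.Icc e₁ (x (m - 1))) ∧
      (∀ t ∈ Set.Ioo e₁ (x (m - 1)), HasDerivAt Qf
        (((g₂ * τ t + 2 * g₃) / (4 * τ t ^ 2) - (g₂ * t + 2 * g₃) / (4 * t ^ 2)) / (-Real.sqrt (f t))) t)) := by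
  intro g₂ g₃ e₁ L₁ m x y f yb sl τ Y3 Qf sl3 X33 Y33 Qf3 Pg G τ' hf he₁ he₁0 hfpos hm6 hxm hgLow hgDec hgAlg hy1
    ay₁ ag₂ ag₃ hL₁ hx2 hy2 hyb hsl hτ hY3 hQf hsl3 hX33 hY33 hQf3 hPg hG hτ' hmono0 himg0 hcell hfanti hfimg hτe₁
    hτm1
  have hx1 : e₁ < x 1 ∧ y 1 < 0 := hgLow 1 le_rfl (by omega)
  have hx2l : e₁ < x 2 ∧ y 2 < 0 := hgLow 2 (by norm_num) (by omega)
  have hx21 : x 2 < x 1 := hgDec 1 le_rfl (by omega)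
  have hanti := asmDecomp_anti x m hgDec
  have hsanti := asmDecomp_strictAnti x m hgDec
  -- the lower-branch package with `xm1 := x (m − 1)`
  have hxm1 : e₁ ≤ x (m - 1) := (hgLow (m - 1) (by omega) (by omega)).1.le
  obtain ⟨L1, L2, L3, L4, L5, L6, L7⟩ := stub_lowerRegular g₂ g₃ e₁ (x 1) (y 1) (x 2) (y 2) L₁ (x (m - 1)) f yb
    sl τ Y3 Qf sl3 X33 Y33 Qf3 Pg G τ' hf he₁ he₁0 hfpos hx1.1 hy1 hx1.2 hL₁ hx2 hy2 hx2l.1 hx2l.2 ag₂ ag₃ (hgAlg 1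
    le_rfl (by omega)) ay₁ hyb hsl hτ hY3 hQf hsl3 hX33 hY33 hQf3 hPg hG hτ'
  obtain ⟨hQfc, hτc, hY3c, hQfd⟩ := L4
  -- `τ > e₁` right of `x (m−1)`
  have hτpos : ∀ t, x (m - 1) < t → e₁ < τ t := by
    intro t ht
    rcases asmDecomp_locate x (m - 1) (by omega) ht with h | ⟨k, hk1, hkm, rfl⟩ | ⟨k, hk1, hkm, hk, hk'⟩
    · have : τ t ∈ Set.Ioo (x 2) (x 1) := by rw [← himg0]; exact ⟨t, h, rfl⟩
      exact hx2l.1.trans this.1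
    · rw [(hcell k hk1 (by omega)).2.2.1]
      exact (hgLow (k + 1) (by omega) (by omega)).1
    · have : τ t ∈ Set.Ioo (x (k + 2)) (x (k + 1)) := by
        rw [← (hcell k hk1 (by omega)).2.1]; exact ⟨t, ⟨hk, hk'⟩, rfl⟩
      rcases Nat.lt_or_ge (k + 2) m with hlt | hge
      · exact (hgLow (k + 2) (by omega) hlt).1.trans this.1
      · have hk2 : k + 2 = m := by omega
        rw [hk2, hxm] at this; exact this.1
  have hxm1_1 : x (m - 1) < x 1 := hsanti 1 (m - 1) le_rfl (by omega) (by omega)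
  have hxm1_2 : x (m - 1) < x 2 := hsanti 2 (m - 1) (by norm_num) (by omega) (by omega)
  have hY3neg : ∀ t, x (m - 1) < t → Y3 t < 0 := L6 hxm1 hτpos hxm1_1
  have hx1pos : 0 < x 1 := he₁0.trans hx1.1
  have hyby : ∀ t, yb t + y 1 < 0 := fun t => by
    simp only [hyb]; linarith [Real.sqrt_nonneg (f t), hx1.2]
  have hfc : Continuous f := by
    rw [show f = fun t => 4 * t ^ 3 - g₂ * t - g₃ from funext hf]; fun_prop
  have hybc : Continuous yb := by rw [hyb]; exact (Real.continuous_sqrt.comp hfc).neg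
  have hGcontAt : ∀ t, Y3 t + y 1 ≠ 0 → τ t ≠ 0 → ContinuousAt G t := by
    intro t h1 h2
    have hybt : yb t + y 1 ≠ 0 := (hyby t).ne
    rw [hG]
    refine ContinuousAt.div ?_ hτc.continuousAt h2
    refine ContinuousAt.mul ?_ ?_
    · refine ContinuousAt.div ?_ ((hybc.continuousAt.add continuousAt_const).pow 2) (pow_ne_zero 2 hybt)
      rw [hPg]
      exact (show Continuous fun t => 4 * (t + 2 * x 1) * y 1 - L₁ * (4 * t ^ 2 + 4 * t * x 1 + 4 * x 1 ^ 2 - g₂)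
        + 4 * (t + 2 * x 1) * yb t by fun_prop).continuousAt
    · refine (continuousAt_id.mul ?_).sqrt
      rw [hX33]
      show ContinuousAt (fun t => sl3 t ^ 2 / 4 - τ t - x 1) t
      refine ContinuousAt.sub (ContinuousAt.sub (ContinuousAt.div_const (ContinuousAt.pow ?_ 2) 4)
        hτc.continuousAt) continuousAt_const
      rw [hsl3]
      show ContinuousAt (fun t => (4 * τ t ^ 2 + 4 * τ t * x 1 + 4 * x 1 ^ 2 - g₂) / (Y3 t + y 1)) t
      exact ContinuousAt.div (by fun_prop) (hY3c.continuousAt.add continuousAt_const) h1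
  -- the special point `t₀ = x (m−1)` (left end of the last regular cell): `G t₀ ≠ 0`
  have hGm1 : G (x (m - 1)) ≠ 0 := by
    set t₀ := x (m - 1) with ht₀
    have ht₀e : e₁ < t₀ := (hgLow (m - 1) (by omega) (by omega)).1
    have hft₀ : 0 < f t₀ := hfpos _ ht₀e
    -- `Y3 t₀ = 0` (on-curve identity at `τ t₀ = e₁`)
    obtain ⟨honC, _, _, _⟩ := stub_translationCalculus g₂ g₃ (x 1) (y 1) (-1) f yb sl τ Y3 Qf hf hy1 (Or.inr rfl)
      (by rw [hyb]; funext t; ring) hsl hτ hY3 hQf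
    have hY30 : Y3 t₀ = 0 := by
      have := honC t₀ hft₀ (hyby t₀).ne
      rw [hτm1, he₁] at this
      exact pow_eq_zero_iff two_ne_zero |>.mp this
    -- `X33 t₀ = τ e₁ = x (m−1)`
    have hX33t₀ : X33 t₀ = x (m - 1) := by
      have hsl3' : sl3 t₀ = sl e₁ := by
        simp only [hsl3, hsl, hyb]
        rw [hY30, hτm1, he₁, Real.sqrt_zero]; ring
      have h1 : X33 t₀ = sl3 t₀ ^ 2 / 4 - τ t₀ - x 1 := by simp only [hX33]
      have h2 : τ e₁ = sl e₁ ^ 2 / 4 - e₁ - x 1 := by simp only [hτ]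
      rw [h1, hsl3', hτm1, ← h2, hτe₁]
    -- `Pg t₀ ≠ 0` by the norm identity
    obtain ⟨_, hnorm, _, _⟩ := stub_dlogPotential g₂ g₃ (x 1) (y 1) (x 2) (y 2) L₁ (-1) f
      (fun t => (-1) * Real.sqrt (f t)) (fun t => (4 * t ^ 2 + 4 * t * x 1 + 4 * x 1 ^ 2 - g₂) / ((-1) * Real.sqrt (f t) + y 1))
      (fun t => ((4 * t ^ 2 + 4 * t * x 1 + 4 * x 1 ^ 2 - g₂) / ((-1) * Real.sqrt (f t) + y 1)) ^ 2 / 4 - t - x 1)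
      _ _ _ _ _ _ _ _ hf hy1 hx1.2.ne (Or.inr rfl) hL₁ hx2 hy2 rfl rfl rfl rfl rfl rfl rfl rfl rfl rfl rfl
    have hM : 0 < 4 * t₀ ^ 2 + 4 * t₀ * x 1 + 4 * x 1 ^ 2 - g₂ := (L1 t₀ ht₀e.le).2
    have hPg0 : Pg t₀ ≠ 0 := by
      intro h0
      have hn := hnorm t₀
      set A := 4 * (t₀ + 2 * x 1) * y 1 - L₁ * (4 * t₀ ^ 2 + 4 * t₀ * x 1 + 4 * x 1 ^ 2 - g₂) with hA
      set B := 4 * (t₀ + 2 * x 1) with hB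
      have hPgt : Pg t₀ = A + B * yb t₀ := by simp only [hPg, hA, hB]
      have hA' : A = B * Real.sqrt (f t₀) := by
        have : yb t₀ = -Real.sqrt (f t₀) := by simp only [hyb]
        rw [hPgt, this] at h0; linarith
      have : A ^ 2 - B ^ 2 * f t₀ = 0 := by
        rw [hA', mul_pow, Real.sq_sqrt hft₀.le]; ring
      rw [this] at hn
      have h2 : t₀ - x 2 ≠ 0 := sub_ne_zero.2 hxm1_2.ne
      have : (-4 : ℝ) * (t₀ - x 2) * (4 * t₀ ^ 2 + 4 * t₀ * x 1 + 4 * x 1 ^ 2 - g₂) ^ 2 ≠ 0 :=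
        mul_ne_zero (mul_ne_zero (by norm_num) h2) (pow_ne_zero 2 hM.ne')
      exact this hn.symm
    simp only [hG]
    rw [hX33t₀, hτm1]
    have h1 : 0 < Real.sqrt (t₀ * x (m - 1)) := Real.sqrt_pos.2 (mul_pos (he₁0.trans ht₀e) (he₁0.trans ht₀e))
    exact div_ne_zero (mul_ne_zero (div_ne_zero hPg0 (pow_ne_zero 2 (hyby t₀).ne)) h1.ne') he₁0.ne'
  refine ⟨hτpos, hY3neg, hτc, fun t _ => hyby t, fun S hS =>
    ⟨(L5 S hS).1, (L5 S hS).2.2.1, (L5 S hS).2.2.2.2.1, (L5 S hS).2.2.2.2.2.2⟩, ?_, ?_⟩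
  · -- regular cells
    intro j hj hjm
    obtain ⟨hmono, himg, hτxj, hτxj1⟩ := hcell j hj hjm
    have hxj1 : e₁ < x (j + 1) := (hgLow (j + 1) (by omega) (by omega)).1
    have hxj2e : e₁ ≤ x (j + 2) := by
      rcases Nat.lt_or_ge (j + 2) m with h | h
      · exact (hgLow (j + 2) (by omega) h).1.le
      · rw [show j + 2 = m by omega, hxm]
    have hrange : ∀ t ∈ Set.Icc (x (j + 1)) (x j),
        e₁ < t ∧ x (j + 2) ≤ τ t ∧ τ t ≤ x (j + 1) ∧ e₁ ≤ τ t ∧ τ t < x 1 := by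
      intro t ht
      have hle : x (j + 1) ≤ x j := ht.1.trans ht.2
      have h1 : τ (x (j + 1)) ≤ τ t := hmono.monotoneOn (left_mem_Icc.2 hle) ht ht.1
      have h2 : τ t ≤ τ (x j) := hmono.monotoneOn ht (right_mem_Icc.2 hle) ht.2
      rw [hτxj1] at h1; rw [hτxj] at h2
      refine ⟨hxj1.trans_le ht.1, h1, h2, hxj2e.trans h1, h2.trans_lt ?_⟩
      exact hsanti 1 (j + 1) le_rfl (by omega) (by omega)
    have hopen : ∀ t ∈ Set.Ioo (x (j + 1)) (x j), e₁ < t ∧ e₁ < τ t ∧ τ t < x 1 ∧ x (m - 1) < t := by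
      intro t ht
      have hτt : τ t ∈ Set.Ioo (x (j + 2)) (x (j + 1)) := by rw [← himg]; exact ⟨t, ht, rfl⟩
      refine ⟨hxj1.trans ht.1, hxj2e.trans_lt hτt.1, hτt.2.trans (hsanti 1 (j + 1) le_rfl (by omega) (by omega)), ?_⟩
      exact (hanti (j + 1) (m - 1) (by omega) (by omega) (by omega)).trans_lt ht.1
    refine ⟨hrange, fun t ht => ?_, ?_, fun t ht => ?_, ?_, ?_, fun t ht => ?_⟩
    · obtain ⟨h1, h2, _⟩ := hopen t ht
      exact ⟨(L2 t h1 h2).1, (L2 t h1 h2).2.2.1⟩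
    · refine continuousOn_of_forall_continuousAt fun t ht => hQfc t ?_ ?_
      · exact (he₁0.trans_le (hrange t ht).2.2.2.1).ne'
      · exact (he₁0.trans (hrange t ht).1).ne'
    · obtain ⟨h1, h2, _⟩ := hopen t ht
      have := hQfd t h1 (he₁0.trans h2).ne'
      simp only [hyb] at this ⊢
      exact this
    · -- continuity of `G` on the closed cell
      refine continuousOn_of_forall_continuousAt fun t ht => hGcontAt t ?_ (he₁0.trans_le (hrange t ht).2.2.2.1).ne'
      -- `Y3 t + y₁ ≠ 0`: strictly inside / right end via `lowerRegular`, left end of the last cell via `Y3 = 0`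
      rcases (hrange t ht).2.2.2.1.eq_or_lt with heq | hlt
      · -- `τ t = e₁`: then `Y3 t = 0`
        obtain ⟨honC, _, _, _⟩ := stub_translationCalculus g₂ g₃ (x 1) (y 1) (-1) f yb sl τ Y3 Qf hf hy1
          (Or.inr rfl) (by rw [hyb]; funext t; ring) hsl hτ hY3 hQf
        have := honC t (hfpos t (hrange t ht).1) (hyby t).ne
        rw [← heq, he₁] at this
        rw [pow_eq_zero_iff two_ne_zero |>.mp this, zero_add]
        exact hx1.2.ne
      · exact (L3 t (hrange t ht).1 hlt (hrange t ht).2.2.2.2).1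
    · -- non-vanishing of `G` on the closed cell
      intro t ht
      rcases (hrange t ht).2.2.2.1.eq_or_lt with heq | hlt
      · -- `τ t = e₁` forces `t = x (m−1)` (injectivity on the cell) — in fact `t` is the left end point
        have hjm' : j + 2 = m := by
          by_contra hne
          have : e₁ < x (j + 2) := (hgLow (j + 2) (by omega) (by omega)).1
          exact absurd ((hrange t ht).2.1) (by rw [← heq]; exact not_le.2 this)
        have ht₀ : t = x (j + 1) := by
          by_contra hne
          have hlt' : x (j + 1) < t := lt_of_le_of_ne ht.1 (Ne.symm hne)
          have := hmono (left_mem_Icc.2 (ht.1.trans ht.2)) ht hlt'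
          rw [hτxj1, hjm', hxm, ← heq] at this
          exact lt_irrefl _ this
        rw [ht₀, show j + 1 = m - 1 by omega]
        exact hGm1
      · exact (L3 t (hrange t ht).1 hlt (hrange t ht).2.2.2.2).2.2.2.1
    · obtain ⟨h1, h2, h3, h4⟩ := hopen t ht
      obtain ⟨_, _, _, _, hGd⟩ := L3 t h1 h2 h3
      rw [(L7 t h1 h2 (hY3neg t h4)).1] at hGd
      exact hGd
  · -- the fold cell
    have hxm1e : e₁ < x (m - 1) := (hgLow (m - 1) (by omega) (by omega)).1
    have hopen : ∀ t ∈ Set.Ioo e₁ (x (m - 1)), e₁ < τ t := by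
      intro t ht
      have : τ t ∈ Set.Ioo e₁ (x (m - 1)) := by rw [← hfimg]; exact ⟨t, ht, rfl⟩
      exact this.1
    refine ⟨fun t ht => ⟨(L2 t ht.1 (hopen t ht)).1, (L2 t ht.1 (hopen t ht)).2.2.1⟩, ?_, fun t ht => ?_⟩
    · refine continuousOn_of_forall_continuousAt fun t ht => hQfc t ?_ (he₁0.trans_le ht.1).ne'
      have h1 : τ t ≤ τ e₁ := hfanti.antitoneOn (left_mem_Icc.2 hxm1e.le) ht ht.1
      have h2 : τ (x (m - 1)) ≤ τ t := hfanti.antitoneOn ht (right_mem_Icc.2 hxm1e.le) ht.2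
      rw [hτm1] at h2
      exact (he₁0.trans_le h2).ne'
    · have := hQfd t ht.1 (he₁0.trans (hopen t ht)).ne'
      simp only [hyb] at this ⊢
      exact this

end Summit.KontsevichZagierPeriods.KontsevichZagierPeriods.Cruxes.NeronTorsionSector.Translation
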